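import Summits.QuantumFields.BalabanUV.Beta.D1BFx.RColumnBlockMass
import Literature.MathematicalPhysics.QuantumFieldTheory.Balaban1983to89.Beta.BalabanStepJetsSucc
import Literature.MathematicalPhysics.QuantumFieldTheory.Balaban1983to89.Beta.LatticeConstantZl

/-!
# `BalabanUV.Beta.D1BFx.GhostWordLegLetters` — road «BF-x» for binder row D1, slot (K), DICT-CHAIN-SPEC §2 (II) row RK-GH, «RK-GH-UNIT» FILE 2 («RK-GH-LEGS»):
# **THE SIX GHOST LEGS `G, P, P∘G, G∘P, G∘G, G∘P∘G` AT `G := Ggh n a`, `P := Pgt n a` WITH n-EXPLICIT `Bdd` ∕ `Decays` ∕ fine-ℓ¹-MASS LETTERS, BY NAME**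
# — every constant a closed n-free expression in `a`, times the displayed power `n⁻⁴` wherever a `Pgt` sup enters

HONEST DEPENDENCY (cell records, verbatim): «continuum YM on T⁴ ⇐ BetaPertH ∧ nine spine estimates (0/9 proved); BetaPertH ⇐ (D1) ∧ (D4) ∧
CAP+tail; G-an2-4 gates asym, D1 and NE2/3/4.»  HONEST FRAMING (cell contract, verbatim): «discharging `BetaPertH` makes Bałaban's UV stability
UNCONDITIONAL — a real constructive-QFT result; it is NOT the continuum limit and NOT the Clay problem.»  THIS MODULE DISCHARGES NOTHING of the
wall: [folklore] bookkeeping BY NAME over the typer's `GhostLeg` (`bdd_Ggh`, `decays_Ggh`, `Ggh_symm`), an3-g57∕gan24-leaf-05's M10 `GhostLegBlockMass.sum_B_abs_Ggh_le`,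
leaf A3.a-P's `ProjectorSupNorm.abs_Pgt_le_sup` ∕ `decays_Pgt_sup` (the SHARP `cPPs·n⁻⁴`), gan24-leaf-05's `ProjectorColumnSharp.tsum_abs_Pgt_col_le_sup`, the block
regrouping `NeedleRowLetters.tsum_eq_tsum_blocks`, `RProjector.abs_tsum_le_latticeConst`, an2's `BalabanStepJetsSucc.decays_comp`, `TameKernelCalculus.decays_of_le`
and `LatticeConstantZl.Zl_le_elem`.  No `def`, no `def … : Prop`, nothing cited, 0 sorry.  NO unit row (FILE 4); 0 root-level binders of row D1 discharged
(hW ∕ hR-sockets ∕ hSX-socket ∕ D1Tel ∕ D1Rep — 0); (K) NOT closed; NOT D1, NOT `BetaPertH`, NOT continuum, NOT Clay.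

ABSOLUTE RULE (cell charter, verbatim): «No internally-minted statement may enter as a cited fact. Every hypothesis is either kernel-proved in
this package or a verbatim quotation of a PUBLISHED theorem with page reference. The manuscript(s) under audit are NOT citable for their own
disputed steps — they are the thing under adjudication; programme-internal (2001/route/tribunal) claims are never citable.»

WHY (journal INTENT 1 «RK-GH-UNIT» [D1LEAF04-G18-ONLINE], OWNER word W-d1p2-g16-5 (B) «THIS SHAPE»).  FILE 1a∕1b (`GhostWordEnvelope`, `GhostWordFamilies`)
bound a ghost word by (one `Decays` leg) × (one `Bdd` leg) × (two jet masses); FILE 4 feeds them, per word of `RestKernelGhostWords.GhIdx`, the letters of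
THIS file: the leg that carries `Pgt` on the `Bdd` side always brings the sharp `cPPs·n⁻⁴` (§3–§4), the other leg an n-free `Decays` letter (§2, §5);
the fine ℓ¹ row∕column masses of `Ggh` and `Pgt` (n-free, from the block masses M10∕M4) turn composites into sups without a volume factor, and the one
`Zl (δ_PP∕(8n))` of `decays_comp` multiplies an `n⁻⁴` (§5: `n⁻⁴·(1 + 16n∕δ_PP)⁴ ≤ (1 + 16∕δ_PP)⁴`).

CONTENT (all [folklore]; `d = 4`, `[NeZero n]`, `0 < a`; `K₄ := B4Sect5Proof.latticeConst 4`; `MG := cNear a·K₄ (ghDelta a)`, `MP := cPPs 4 a·K₄ (deltaPP 4 a)`):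
* §1 composites at fibre `Unit`: `decays_of_le_const`, **`bdd_comp_of_bdd_col`** (`Bdd A S`, column masses of `B` `≤ M` ⊢ `Bdd (A∘B) (S·M)`), **`bdd_comp_of_row_bdd`**.
* §2 `G`: `summable_abs_Ggh_col`∕`_row`, **`tsum_abs_Ggh_col_le`**∕**`tsum_abs_Ggh_row_le`** (`≤ MG`), **`decays_Ggh_PP`** (`Decays (Ggh n a) (2∕min 2 a) (δ_PP∕(4n))`, rate lowered).
* §3 `P`: **`bdd_Pgt_sup`** (`Bdd (Pgt n a) (cPPs∕n⁴)`), `summable_abs_Pgt_row`, **`tsum_abs_Pgt_row_le_sup`** (`≤ MP`).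
* §4 composite sups: **`bdd_comp_Pgt_Ggh`** (`cPPs∕n⁴·MG`), **`bdd_comp_Ggh_Pgt`** (`MG·cPPs∕n⁴`), **`bdd_comp_Ggh_Ggh`** (`(2∕min 2 a)·MG`), **`bdd_comp_Ggh_Pgt_Ggh`** (`MG·(cPPs∕n⁴·MG)`).
* §5 composite decay, n-free: `Zl_PP_le` (`(n⁴)⁻¹·Zl 4 (δ_PP∕(8n)) ≤ (1 + 16∕δ_PP)⁴`), **`decays_comp_Pgt_Ggh`**∕**`decays_comp_Ggh_Pgt`**
  (`Decays (P∘G) (cPPs·e^{δ_PP}·(2∕min 2 a)·(1 + 16∕δ_PP)⁴) (δ_PP∕(8n))`, same for `G∘P`).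
NOT HERE (honest): the jets' masses (FILE 3), any word bound or (1.22) row (FILE 4).
Unit `b2b-balaban-beta-d1-formalise-leaf-04` (gen 18), D1 formalisation swarm leaf prover 04, road «BF-x»; INTENT 1 «RK-GH-UNIT» FILE 2 (journal).
-/

noncomputable section

namespace Summit.QuantumFields.BalabanUV.Beta.D1BFx.GhostWordLegLetters

open Finset
open scoped BigOperators
open Literature.MathematicalPhysics.QuantumFieldTheory.Balaban1983to89
open Literature.MathematicalPhysics.QuantumFieldTheory.Balaban1983to89.Beta
open B12Sec2to5 (l1 l1_nonneg)
open B4Sect5Proof (latticeConst latticeConst_nonneg)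
open B6QGQLower276 (X blk B mem_B)
open B6QGQDecay237 (deltaU deltaU_pos)
open ExpKernelCalculus (Site MKer Decays comp Zl Zl_pos summable_exp_shift')
open KernelWard (Bdd)
open BalabanStepJetsSucc (decays_comp)
open LatticeConstantZl (Zl_le_elem)
open Summit.QuantumFields.BalabanUV.Beta.TameKernelCalculus (decays_of_le)
open Summit.QuantumFields.BalabanUV.Beta.D1BFx.RProjector (Pgt Pgt_symm abs_tsum_le_latticeConst deltaP deltaPP deltaPP_pos)
open Summit.QuantumFields.BalabanUV.Beta.D1BFx.ProjectorSupNorm (cPPs cPPs_nonneg abs_Pgt_le_sup decays_Pgt_sup)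
open Summit.QuantumFields.BalabanUV.Beta.D1BFx.ProjectorColumnSharp (summable_abs_Pgt_col tsum_abs_Pgt_col_le_sup)
open Summit.QuantumFields.BalabanUV.Beta.D1BFx.GhostLeg (Ggh Ggh_symm decays_Ggh bdd_Ggh const_nonneg)
open Summit.QuantumFields.BalabanUV.Beta.D1BFx.NeedleRowLetters (tsum_eq_tsum_blocks)
open Summit.QuantumFields.BalabanUV.Beta.D1BFx.GhostLegFree (ghDelta ghDelta_pos)
open Summit.QuantumFields.BalabanUV.Beta.D1BFx.GhostLegBlockMass (cNear sum_B_abs_Ggh_le)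
open Summit.QuantumFields.BalabanUV.Beta.D1BFx.RColumnBlockMass (cNear_nonneg sum_B_abs_Ggh_col_le)

/-! ## §1 Composites of scalar kernels: sups from a sup and a fine ℓ¹ mass -/

section Generic

variable {D : ℕ}

/-- [folklore] Enlarging the constant of a `Decays` letter. -/
theorem decays_of_le_const {A : MKer D Unit} {C C' δ : ℝ} (h : Decays A C δ) (hCC' : C ≤ C') : Decays A C' δ := fun x y a b =>
  (h x y a b).trans (mul_le_mul_of_nonneg_right hCC' (Real.exp_pos _).le)

/-- [folklore] **SUP × COLUMN MASS**: `Bdd A S` (`0 ≤ S`) and summable columns of `B` with `Σ'_y |B y z| ≤ M` give `Bdd (comp A B) (S·M)`. -/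
theorem bdd_comp_of_bdd_col {A B : MKer D Unit} {S M : ℝ} (hA : Bdd A S) (hS : 0 ≤ S)
    (hBs : ∀ z, Summable fun y : Site D => |B y z () ()|) (hBm : ∀ z, ∑' y : Site D, |B y z () ()| ≤ M) :
    Bdd (comp A B) (S * M) := by
  intro x z a b
  cases a; cases b
  unfold ExpKernelCalculus.comp
  have hmaj := (hBs z).mul_left S
  have hb := tsum_of_norm_bounded (f := fun y => ∑ f : Unit, A x y () f * B y z f ()) hmaj.hasSum (fun y => by
    rw [Real.norm_eq_abs, Fintype.sum_unique, abs_mul]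
    exact mul_le_mul_of_nonneg_right (hA x y () ()) (abs_nonneg _))
  rw [Real.norm_eq_abs, tsum_mul_left] at hb
  exact hb.trans (mul_le_mul_of_nonneg_left (hBm z) hS)

/-- [folklore] **ROW MASS × SUP**: summable rows of `A` with `Σ'_y |A x y| ≤ M` and `Bdd B S` (`0 ≤ S`) give `Bdd (comp A B) (M·S)`. -/
theorem bdd_comp_of_row_bdd {A B : MKer D Unit} {S M : ℝ} (hAs : ∀ x, Summable fun y : Site D => |A x y () ()|)
    (hAm : ∀ x, ∑' y : Site D, |A x y () ()| ≤ M) (hB : Bdd B S) (hS : 0 ≤ S) :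
    Bdd (comp A B) (M * S) := by
  intro x z a b
  cases a; cases b
  unfold ExpKernelCalculus.comp
  have hmaj := (hAs x).mul_right S
  have hb := tsum_of_norm_bounded (f := fun y => ∑ f : Unit, A x y () f * B y z f ()) hmaj.hasSum (fun y => by
    rw [Real.norm_eq_abs, Fintype.sum_unique, abs_mul]
    exact mul_le_mul_of_nonneg_left (hB y z () ()) (abs_nonneg _))
  rw [Real.norm_eq_abs, tsum_mul_right] at hb
  exact hb.trans (mul_le_mul_of_nonneg_right (hAm x) hS)

end Generic

variable (n : ℕ) [NeZero n] {a : ℝ}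

/-! ## §2 The ghost leg `G = Ggh n a`: fine ℓ¹ masses (n-free) and the rate-lowered decay -/

/-- [folklore] The columns `x ↦ |Ggh n a x y|` are summable over `ℤ⁴` (`decays_Ggh`). -/
theorem summable_abs_Ggh_col (ha : 0 < a) (y : X 4) : Summable fun x : X 4 => |Ggh n a x y () ()| := by
  have hn : (0 : ℝ) < n := Nat.cast_pos.mpr (Nat.pos_of_ne_zero (NeZero.ne n))
  have hD := decays_Ggh n a ha
  have hδ : 0 < deltaU 4 a / (4 * (n : ℝ)) := div_pos (deltaU_pos 4 ha) (by positivity)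
  exact Summable.of_nonneg_of_le (fun x => abs_nonneg _) (fun x => hD x y () ()) ((summable_exp_shift' hδ y).mul_left _)

/-- [folklore] **THE FINE ℓ¹ COLUMN OF THE GHOST LEG IS n-FREE**: `Σ'_x |Ggh n a x y| ≤ cNear a·K₄(ghDelta a)` (block regrouping + M10 in column form). -/
theorem tsum_abs_Ggh_col_le (ha : 0 < a) (y : X 4) :
    ∑' x : X 4, |Ggh n a x y () ()| ≤ cNear a * latticeConst 4 (ghDelta a) := by
  rw [tsum_eq_tsum_blocks (n - 1) (summable_abs_Ggh_col n ha y)]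
  refine (le_abs_self _).trans (abs_tsum_le_latticeConst (ghDelta_pos ha) (cNear_nonneg ha) (blk (n - 1) y) fun w => ?_)
  rw [abs_of_nonneg (Finset.sum_nonneg fun z _ => abs_nonneg _), dist_comm]
  exact sum_B_abs_Ggh_col_le n ha y w

/-- [folklore] The rows `y ↦ |Ggh n a x y|` are summable over `ℤ⁴` (`Ggh_symm`). -/
theorem summable_abs_Ggh_row (ha : 0 < a) (x : X 4) : Summable fun y : X 4 => |Ggh n a x y () ()| :=
  (summable_abs_Ggh_col n ha x).congr fun y => by rw [Ggh_symm n a ha y x () ()]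

/-- [folklore] **THE FINE ℓ¹ ROW OF THE GHOST LEG IS n-FREE**: `Σ'_y |Ggh n a x y| ≤ cNear a·K₄(ghDelta a)`. -/
theorem tsum_abs_Ggh_row_le (ha : 0 < a) (x : X 4) :
    ∑' y : X 4, |Ggh n a x y () ()| ≤ cNear a * latticeConst 4 (ghDelta a) := by
  have e : ∑' y : X 4, |Ggh n a x y () ()| = ∑' y : X 4, |Ggh n a y x () ()| := tsum_congr fun y => by rw [Ggh_symm n a ha x y () ()]
  rw [e]; exact tsum_abs_Ggh_col_le n ha x

/-- [folklore] `δ_PP(4,a) ≤ δ_u(4,a)` (`δ_PP = min(δ_P, δ_u)∕2`). -/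
theorem deltaPP_le_deltaU (ha : 0 < a) : deltaPP 4 a ≤ deltaU 4 a := by
  unfold RProjector.deltaPP
  have h := min_le_right (deltaP 4 a) (deltaU 4 a)
  have h0 := deltaU_pos 4 ha
  linarith

/-- [folklore] **THE GHOST LEG AT THE PROJECTOR'S RATE**: `Decays (Ggh n a) (2∕min 2 a) (δ_PP∕(4n))` (`decays_Ggh`, rate lowered by `decays_of_le`). -/
theorem decays_Ggh_PP (ha : 0 < a) : Decays (Ggh n a) (2 / min 2 a) (deltaPP 4 a / (4 * (n : ℝ))) := by
  have hn : (0 : ℝ) < n := Nat.cast_pos.mpr (Nat.pos_of_ne_zero (NeZero.ne n))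
  have h := decays_of_le (decays_Ggh n a ha) (δ' := deltaPP 4 a / (4 * (n : ℝ)))
    (div_le_div_of_nonneg_right (deltaPP_le_deltaU ha) (by positivity))
  rwa [abs_of_nonneg (const_nonneg a ha)] at h

/-! ## §3 The projector `P = Pgt n a`: the sharp sup and the fine ℓ¹ row -/

/-- [folklore] **THE SHARP SUP OF THE PROJECTOR**: `Bdd (Pgt n a) (cPPs(4,a)∕n⁴)` (`ProjectorSupNorm.abs_Pgt_le_sup`, exponential `≤ 1`). -/
theorem bdd_Pgt_sup (ha : 0 < a) : Bdd (Pgt n a) (cPPs 4 a / (n : ℝ) ^ 4) := by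
  intro x y u v
  have hn : (0 : ℝ) < n := Nat.cast_pos.mpr (Nat.pos_of_ne_zero (NeZero.ne n))
  refine (abs_Pgt_le_sup n ha x y u v).trans (mul_le_of_le_one_right (div_nonneg (cPPs_nonneg 4 ha) (pow_pos hn 4).le) ?_)
  rw [Real.exp_le_one_iff, neg_nonpos]
  exact mul_nonneg (deltaPP_pos 4 ha).le dist_nonneg

/-- [folklore] The rows of `|Pgt|` are summable (`Pgt_symm` + `summable_abs_Pgt_col`). -/
theorem summable_abs_Pgt_row (ha : 0 < a) (x : X 4) : Summable fun y : X 4 => |Pgt n a x y () ()| :=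
  (summable_abs_Pgt_col n ha x () ()).congr fun y => by rw [Pgt_symm n ha y x () ()]

/-- [folklore] **THE FINE ℓ¹ ROW OF THE PROJECTOR IS n-FREE**: `Σ'_y |Pgt n a x y| ≤ cPPs(4,a)·K₄(δ_PP(4,a))` (M4′ + `Pgt_symm`). -/
theorem tsum_abs_Pgt_row_le_sup (ha : 0 < a) (x : X 4) :
    ∑' y : X 4, |Pgt n a x y () ()| ≤ cPPs 4 a * latticeConst 4 (deltaPP 4 a) := by
  have e : ∑' y : X 4, |Pgt n a x y () ()| = ∑' y : X 4, |Pgt n a y x () ()| := tsum_congr fun y => by rw [Pgt_symm n ha x y () ()]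
  rw [e]; exact tsum_abs_Pgt_col_le_sup n ha x () ()

/-! ## §4 The composite legs' sups: every `Pgt` factor brings `n⁻⁴`, every `Ggh` factor an n-free mass or sup -/

/-- [folklore] **`P∘G`**: `Bdd (comp (Pgt n a) (Ggh n a)) (cPPs∕n⁴ · (cNear·K₄(ghDelta)))`. -/
theorem bdd_comp_Pgt_Ggh (ha : 0 < a) :
    Bdd (comp (Pgt n a) (Ggh n a)) (cPPs 4 a / (n : ℝ) ^ 4 * (cNear a * latticeConst 4 (ghDelta a))) := by
  have hn : (0 : ℝ) < n := Nat.cast_pos.mpr (Nat.pos_of_ne_zero (NeZero.ne n))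
  exact bdd_comp_of_bdd_col (bdd_Pgt_sup n ha) (div_nonneg (cPPs_nonneg 4 ha) (pow_pos hn 4).le)
    (summable_abs_Ggh_col n ha) (tsum_abs_Ggh_col_le n ha)

/-- [folklore] **`G∘P`**: `Bdd (comp (Ggh n a) (Pgt n a)) ((cNear·K₄(ghDelta)) · cPPs∕n⁴)`. -/
theorem bdd_comp_Ggh_Pgt (ha : 0 < a) :
    Bdd (comp (Ggh n a) (Pgt n a)) ((cNear a * latticeConst 4 (ghDelta a)) * (cPPs 4 a / (n : ℝ) ^ 4)) := by
  have hn : (0 : ℝ) < n := Nat.cast_pos.mpr (Nat.pos_of_ne_zero (NeZero.ne n))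
  exact bdd_comp_of_row_bdd (summable_abs_Ggh_row n ha) (tsum_abs_Ggh_row_le n ha) (bdd_Pgt_sup n ha)
    (div_nonneg (cPPs_nonneg 4 ha) (pow_pos hn 4).le)

/-- [folklore] **`G∘G`**: `Bdd (comp (Ggh n a) (Ggh n a)) ((2∕min 2 a) · (cNear·K₄(ghDelta)))`. -/
theorem bdd_comp_Ggh_Ggh (ha : 0 < a) :
    Bdd (comp (Ggh n a) (Ggh n a)) (2 / min 2 a * (cNear a * latticeConst 4 (ghDelta a))) :=
  bdd_comp_of_bdd_col (bdd_Ggh n a ha) (const_nonneg a ha) (summable_abs_Ggh_col n ha) (tsum_abs_Ggh_col_le n ha)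

/-- [folklore] **`G∘P∘G`**: `Bdd (comp (Ggh n a) (comp (Pgt n a) (Ggh n a))) ((cNear·K₄(ghDelta)) · (cPPs∕n⁴ · (cNear·K₄(ghDelta))))`. -/
theorem bdd_comp_Ggh_Pgt_Ggh (ha : 0 < a) :
    Bdd (comp (Ggh n a) (comp (Pgt n a) (Ggh n a)))
      ((cNear a * latticeConst 4 (ghDelta a)) * (cPPs 4 a / (n : ℝ) ^ 4 * (cNear a * latticeConst 4 (ghDelta a)))) := by
  have hn : (0 : ℝ) < n := Nat.cast_pos.mpr (Nat.pos_of_ne_zero (NeZero.ne n))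
  have h0 : 0 ≤ cPPs 4 a / (n : ℝ) ^ 4 * (cNear a * latticeConst 4 (ghDelta a)) :=
    mul_nonneg (div_nonneg (cPPs_nonneg 4 ha) (pow_pos hn 4).le) (mul_nonneg (cNear_nonneg ha) (latticeConst_nonneg 4 (ghDelta_pos ha).le))
  exact bdd_comp_of_row_bdd (summable_abs_Ggh_row n ha) (tsum_abs_Ggh_row_le n ha) (bdd_comp_Pgt_Ggh n ha) h0

/-! ## §5 The composite legs' decay: the one `Zl` multiplies an `n⁻⁴` -/

/-- [folklore] **THE VOLUME FACTOR IS AFFORDABLE NEXT TO `n⁻⁴`**: `(n⁴)⁻¹·Zl 4 (δ_PP∕(8n)) ≤ (1 + 16∕δ_PP)⁴` (`Zl_le_elem`: `Zl 4 c ≤ (1 + 2∕c)⁴`,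
`2∕c = 16n∕δ_PP`, and `(1 + 16n∕δ_PP)∕n ≤ 1 + 16∕δ_PP` for `n ≥ 1`). -/
theorem Zl_PP_le (ha : 0 < a) :
    ((n : ℝ) ^ 4)⁻¹ * Zl 4 (deltaPP 4 a / (8 * (n : ℝ))) ≤ (1 + 16 / deltaPP 4 a) ^ 4 := by
  have hn : (1 : ℝ) ≤ n := by exact_mod_cast NeZero.one_le
  have hn0 : (0 : ℝ) < n := by positivity
  have hδ := deltaPP_pos 4 ha
  have hc : 0 < deltaPP 4 a / (8 * (n : ℝ)) := by positivity
  have h1 := Zl_le_elem hc 4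
  have e : 1 + 2 / (deltaPP 4 a / (8 * (n : ℝ))) = 1 + 16 * n / deltaPP 4 a := by field_simp; ring
  rw [e] at h1
  have h2 : (1 + 16 * (n : ℝ) / deltaPP 4 a) ≤ n * (1 + 16 / deltaPP 4 a) := by
    have e2 : (n : ℝ) * (1 + 16 / deltaPP 4 a) = n + 16 * (n : ℝ) / deltaPP 4 a := by ring
    rw [e2]
    linarith
  have h3 : (1 + 16 * (n : ℝ) / deltaPP 4 a) ^ 4 ≤ ((n : ℝ) * (1 + 16 / deltaPP 4 a)) ^ 4 :=
    pow_le_pow_left₀ (by positivity) h2 4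
  rw [mul_pow] at h3
  rw [inv_mul_le_iff₀ (pow_pos hn0 4)]
  exact h1.trans h3

/-- [folklore] **`P∘G` DECAYS WITH AN n-FREE CONSTANT**: `Decays (comp (Pgt n a) (Ggh n a)) (cPPs·e^{δ_PP}·(2∕min 2 a)·(1 + 16∕δ_PP)⁴) (δ_PP∕(8n))`
(`decays_comp` at the common rate `δ_PP∕(4n)`, halved; the `Zl 4 (δ_PP∕(8n))` against `decays_Pgt_sup`'s `n⁻⁴` by `Zl_PP_le`). -/
theorem decays_comp_Pgt_Ggh (ha : 0 < a) :
    Decays (comp (Pgt n a) (Ggh n a)) (cPPs 4 a * Real.exp (deltaPP 4 a) * (2 / min 2 a) * (1 + 16 / deltaPP 4 a) ^ 4)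
      (deltaPP 4 a / (8 * (n : ℝ))) := by
  have hn0 : (0 : ℝ) < n := Nat.cast_pos.mpr (Nat.pos_of_ne_zero (NeZero.ne n))
  have hδ := deltaPP_pos 4 ha
  have h := decays_comp (decays_Pgt_sup n ha) (decays_Ggh_PP n ha) (δ' := deltaPP 4 a / (8 * (n : ℝ))) (by positivity)
    (by rw [div_lt_div_iff_of_pos_left hδ (by positivity) (by positivity)]; linarith)
  have e : deltaPP 4 a / (4 * (n : ℝ)) - deltaPP 4 a / (8 * (n : ℝ)) = deltaPP 4 a / (8 * (n : ℝ)) := by field_simp; ring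
  rw [e] at h
  refine decays_of_le_const h ?_
  rw [Fintype.card_unit, Nat.cast_one, one_mul]
  have hZ := Zl_PP_le n ha
  have hK : 0 ≤ cPPs 4 a * Real.exp (deltaPP 4 a) * (2 / min 2 a) := mul_nonneg (mul_nonneg (cPPs_nonneg 4 ha) (Real.exp_pos _).le) (const_nonneg a ha)
  calc cPPs 4 a / (n : ℝ) ^ 4 * Real.exp (deltaPP 4 a) * (2 / min 2 a) * Zl 4 (deltaPP 4 a / (8 * (n : ℝ)))
      = (cPPs 4 a * Real.exp (deltaPP 4 a) * (2 / min 2 a)) * (((n : ℝ) ^ 4)⁻¹ * Zl 4 (deltaPP 4 a / (8 * (n : ℝ)))) := by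
        field_simp
    _ ≤ (cPPs 4 a * Real.exp (deltaPP 4 a) * (2 / min 2 a)) * (1 + 16 / deltaPP 4 a) ^ 4 := mul_le_mul_of_nonneg_left hZ hK

/-- [folklore] **`G∘P` DECAYS WITH THE SAME n-FREE CONSTANT**: `Decays (comp (Ggh n a) (Pgt n a)) ((2∕min 2 a)·(cPPs·e^{δ_PP})·(1 + 16∕δ_PP)⁴) (δ_PP∕(8n))`. -/
theorem decays_comp_Ggh_Pgt (ha : 0 < a) :
    Decays (comp (Ggh n a) (Pgt n a)) ((2 / min 2 a) * (cPPs 4 a * Real.exp (deltaPP 4 a)) * (1 + 16 / deltaPP 4 a) ^ 4)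
      (deltaPP 4 a / (8 * (n : ℝ))) := by
  have hn0 : (0 : ℝ) < n := Nat.cast_pos.mpr (Nat.pos_of_ne_zero (NeZero.ne n))
  have hδ := deltaPP_pos 4 ha
  have h := decays_comp (decays_Ggh_PP n ha) (decays_Pgt_sup n ha) (δ' := deltaPP 4 a / (8 * (n : ℝ))) (by positivity)
    (by rw [div_lt_div_iff_of_pos_left hδ (by positivity) (by positivity)]; linarith)
  have e : deltaPP 4 a / (4 * (n : ℝ)) - deltaPP 4 a / (8 * (n : ℝ)) = deltaPP 4 a / (8 * (n : ℝ)) := by field_simp; ring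
  rw [e] at h
  refine decays_of_le_const h ?_
  rw [Fintype.card_unit, Nat.cast_one, one_mul]
  have hZ := Zl_PP_le n ha
  have hK : 0 ≤ (2 / min 2 a) * (cPPs 4 a * Real.exp (deltaPP 4 a)) := mul_nonneg (const_nonneg a ha) (mul_nonneg (cPPs_nonneg 4 ha) (Real.exp_pos _).le)
  calc (2 / min 2 a) * (cPPs 4 a / (n : ℝ) ^ 4 * Real.exp (deltaPP 4 a)) * Zl 4 (deltaPP 4 a / (8 * (n : ℝ)))
      = ((2 / min 2 a) * (cPPs 4 a * Real.exp (deltaPP 4 a))) * (((n : ℝ) ^ 4)⁻¹ * Zl 4 (deltaPP 4 a / (8 * (n : ℝ)))) := by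
        field_simp
    _ ≤ ((2 / min 2 a) * (cPPs 4 a * Real.exp (deltaPP 4 a))) * (1 + 16 / deltaPP 4 a) ^ 4 := mul_le_mul_of_nonneg_left hZ hK

end Summit.QuantumFields.BalabanUV.Beta.D1BFx.GhostWordLegLetters

end
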